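import Literature.Computability.Complexity.ReductionData
import Literature.Computability.Complexity.KeyImplication
import Literature.Computability.Complexity.MassProduction
import HarnessLib

/-!
# Hirahara's reduction: completeness (the small circuit of a light satisfying assignment)

Topic `Computability/Complexity`. The completeness half of Hirahara's Lemma 8.3 for `MCSP*`
(ECCC TR22-119, pp. 28–30, with Lemma 8.2 = Uhlig's mass production and Lemma 4.5 = linear
reconstruction of the Benaloh–Leichter scheme): if `T ⊆ [n]` satisfies every formula `φⱼ`, then for
EVERY outcome of the coins `F` there is a `B₂`-circuit on the bits of the sample index
`x = (j, z, ξ)` that answers the secret `b` at every sample point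
(`HiraharaRed.Cons` of `KeyImplication.lean`), of size

  `∑_{k ∈ T} (Δ·k_A·N_k·(2 m_k + 3) + 160·2^{N_k}/N_k + Δ·(k_A + 1)) + (2^{Lj+1}) + ν·(2Δ + 1) + (2ν + 1)`:

for each `k ∈ T` the `Δ·k_A` queries of the amplified functions `f̂_k` at the blocks `z|_{S_{(k,t)}}`
are linear functions of the seed bits (Hankel hitter), the values of `f_k` at all of them are mass
produced (`cktSize_massProduction`), XORed to `f̂_k` (`parityFin`); the shares of the parties in `T` are
unmasked (`ξ ⊕ f̂`), each formula reconstructs `b` as an XOR of share bits of its first `T`-term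
(Lemma 4.5), and the formula index `j` (in binary) selects the answer through the minterms of its bits
(`Lupanov.cktSize_allMinterms`, mutually exclusive, summed by an XOR chain).

* `HiraharaRed.SB`, `seedOf`, `Layout` — the seed of variable `k` is read off a block by wires;
* `HiraharaRed.XB`, `xbits` — the bit-level sample index (`j` in binary, `z`, `ξ`);
* `HiraharaRed.cktSize_cons` — **the completeness circuit** (as a `CktSize` statement) and
  `HiraharaRed.exists_circuit_cons` (as a `Circuit`).

## References

* S. Hirahara, *NP-hardness of learning programs and partial MCSP*, ECCC TR22-119, proof of
  Lemma 8.3 (completeness, pp. 29–30), Lemma 8.2, Lemma 4.5 [Hirahara2022PartialMCSP].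
* D. Uhlig, *Networks computing Boolean functions for multiple input values*, in: Boolean Function
  Complexity, LMS LNS 169, CUP 1992 [Uhlig1992].
-/

namespace Literature.Computability.Complexity

open Finset
open Literature.Computability.MetaComplexity (MonotoneDNF)
open Literature.Computability.MetaComplexity.MonotoneDNF (BenalohLeichter.Rand BenalohLeichter.share bitZ zBit)

namespace HiraharaRed

open IWAmp

/-! ### Parities over `𝔽₂` as XOR chains -/

section Parity

/-- `[u + v ≠ 0] = [u ≠ 0] ⊕ [v ≠ 0]` in `𝔽₂`. [folklore] -/
theorem decide_add_ne_zero (u v : ZMod 2) : decide (u + v ≠ 0) = xor (decide (u ≠ 0)) (decide (v ≠ 0)) := by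
  revert u v; decide

/-- `[u · v ≠ 0] = [u ≠ 0] ∧ [v ≠ 0]` in `𝔽₂`. [folklore] -/
theorem decide_mul_ne_zero (u v : ZMod 2) : decide (u * v ≠ 0) = (decide (u ≠ 0) && decide (v ≠ 0)) := by
  revert u v; decide

/-- A sum over `𝔽₂` is nonzero iff the XOR of the indicator bits is `1`. [folklore] -/
theorem decide_sum_ne_zero : ∀ (M : ℕ) (a : Fin M → ZMod 2),
    decide ((∑ c, a c) ≠ 0) = parityFin M (fun c => decide (a c ≠ 0))
  | 0, a => by simp [parityFin]
  | M + 1, a => by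
    rw [Fin.sum_univ_castSucc, parityFin, decide_add_ne_zero, decide_sum_ne_zero M]

/-- `zBit (∑ bitZ bᵢ)` is the XOR of the bits. [folklore] -/
theorem zBit_sum_bitZ (M : ℕ) (b : Fin M → Bool) : zBit (∑ c, bitZ (b c)) = parityFin M b := by
  have h1 : zBit (∑ c, bitZ (b c)) = decide ((∑ c, bitZ (b c)) ≠ 0) := by
    generalize (∑ c, bitZ (b c)) = u; revert u; decide
  rw [h1, decide_sum_ne_zero]
  congr 1; funext c; cases b c <;> decide

/-- The masked parity `⊕_c (w_c ∧ m_c)` with a CONSTANT mask costs `2M + 1` gates. [cite: Uhlig1992, proof of Thm. 2.1 (network S_⊕); Vollmer1999, §1.1] -/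
theorem cktSize_maskedParityConst (M : ℕ) (mask : Fin M → Bool) :
    CktSize B2 (fun (w : Fin M → Bool) (_ : Unit) => parityFin M fun c => w c && mask c) (2 * M + 1) := by
  have hA : CktSize B2 (fun (w : Fin M → Bool) (c : Fin M) => w c && mask c) (Fintype.card (Fin M) * 1) :=
    CktSize.pi_const fun c => (cktSize_bin (fun u _ => u && mask c) c c).congr fun _ _ => rfl
  have h := hA.comp (cktSize_parityFin M)
  rw [Fintype.card_fin, mul_one] at h
  exact h.of_le (by omega)

end Parity

/-! ### The seed of a variable, read off a block by wires -/

section SeedBits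

/-- The seed-bit wires of a variable with parameters `(N, d, m)`: design part, Hankel `t`-part,
Hankel `b`-part. [cite: Hirahara2022PartialMCSP, proof of Lemma 8.1 (seed (z, r) of Amp)] -/
abbrev SB (N d m : ℕ) : Type := Fin d ⊕ (Fin (N + m) ⊕ Fin N)

/-- Bits to `𝔽₂`. [folklore] -/
def bz (b : Bool) : ZMod 2 := if b then 1 else 0

/-- `bz b ≠ 0 ↔ b`. [folklore] -/
@[simp] theorem decide_bz_ne_zero (b : Bool) : decide (bz b ≠ 0) = b := by cases b <;> decide

/-- The seed assembled from its bits. [cite: Hirahara2022PartialMCSP, proof of Lemma 8.1] -/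
def seedOf {N d m : ℕ} (u : SB N d m → Bool) : Seed N d m :=
  (fun r => u (.inl r), (fun c => bz (u (.inr (.inl c))), fun r => bz (u (.inr (.inr r)))))

variable {N d m kA : ℕ}

/-- The hitter bits as an explicit XOR of seed bits: `Hit(y)ᵢ(r) = b_r ⊕ ⊕_{c : idx i c ≠ 0} t_{r+c}`.
[cite: Hirahara2022PartialMCSP, proof of Lemma 8.1 (pairwise independent generator, Claim 8 of IW97)] -/
theorem hitB_seedOf (idx : Fin kA → Fin m → ZMod 2) (u : SB N d m → Bool) (i : Fin kA) (r : Fin N) :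
    hitB idx (seedOf u).2 i r =
      xor (parityFin m fun c => u (.inr (.inl ⟨r + c, by omega⟩)) && decide (idx i c ≠ 0))
        (u (.inr (.inr r))) := by
  unfold hitB Hankel.gen Hankel.mulVec seedOf
  simp only [Pi.add_apply]
  rw [decide_add_ne_zero, decide_sum_ne_zero]
  congr 1
  · congr 1; funext c; rw [decide_mul_ne_zero, decide_bz_ne_zero]
  · exact decide_bz_ne_zero _

/-- **The query circuit**: the `i`-th amplification input `wᵢ(σ) = x|_{Sᵢ} ⊕ Hit(y)ᵢ` as a function of
the seed bits costs `N (2m + 3)` gates. [cite: Hirahara2022PartialMCSP, proof of Lemma 8.1 (z_{Sᵢ} ⊕ H(r)ᵢ) and proof of Lemma 8.3 (completeness: "each bit of ẑ is computable by O(log λ)-size circuits")] -/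
theorem cktSize_inp (e : Fin kA → (Fin N ↪ Fin d)) (idx : Fin kA → Fin m → ZMod 2) (i : Fin kA) :
    CktSize B2 (fun (u : SB N d m → Bool) (r : Fin N) => inp e idx i (seedOf u) r) (N * (2 * m + 3)) := by
  have hrow : ∀ r : Fin N, CktSize B2 (fun (u : SB N d m → Bool) (_ : Unit) => inp e idx i (seedOf u) r)
      (2 * m + 3) := by
    intro r
    -- masked parity of the shifted `t`-bits, then `⊕ b_r`, then `⊕ x_{e i r}`
    have h1 : CktSize B2 (fun (u : SB N d m → Bool) =>
        Sum.elim u (fun (_ : Unit) => parityFin m fun c => u (.inr (.inl ⟨r + c, by omega⟩)) && decide (idx i c ≠ 0)))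
        (0 + (2 * m + 1)) :=
      (CktSize.id B2).pair ((cktSize_maskedParityConst m fun c => decide (idx i c ≠ 0)).rewire
        fun c => (.inr (.inl ⟨r + c, by omega⟩) : SB N d m))
    have h2 := (h1.andThen xor (.inr ()) (.inl (.inr (.inr r)))).andThen xor (.inl (.inl (.inl (e i r)))) (.inr ())
    refine (h2.outMap fun _ : Unit => (Sum.inr () : _ ⊕ Unit)).of_le (by omega) |>.congr fun u _ => ?_
    simp only [Sum.elim_inr, Sum.elim_inl]
    unfold inp
    rw [hitB_seedOf]
    rfl
  have h := CktSize.pi (f := fun (u : SB N d m → Bool) (r : Fin N) => inp e idx i (seedOf u) r) hrow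
  simpa [sum_const, card_univ] using h

end SeedBits

/-! ### The block circuit of one variable and of a set of variables -/

section Blocks

variable {n ℓ kA Δ dNW : ℕ} (A : AmpData n ℓ kA)

/-- **Layout**: the seed of variable `k` is read off an `ℓ`-bit block by fixed wires (the
identification `Φ_k` is a coordinate projection followed by `Bool ≃ 𝔽₂`). [cite: Hirahara2022PartialMCSP, proof of Lemma 8.3 ("the last ℓ − cn bits are ignored")] -/
structure Layout where
  /-- the wire of each seed bit -/
  lay : (k : Fin n) → SB (A.N k) (A.dA k) (A.mI k) → Fin ℓ
  /-- reading the block through the wires gives the seed -/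
  spec : ∀ (k : Fin n) (y : Fin ℓ → Bool), ((A.Φ k).symm y).1 = seedOf fun sb => y (lay k sb)

variable (E : Fin n × Fin Δ → (Fin ℓ ↪ Fin dNW))

/-- The gate budget of one variable: queries, mass production, XORs. [cite: Hirahara2022PartialMCSP, proof of Lemma 8.3 (completeness: O(|f_k|/log|f_k|) per variable plus poly(log) overheads)] -/
def costK (Δ kA : ℕ) (k : Fin n) : ℕ :=
  Δ * kA * (A.N k * (2 * A.mI k + 3)) + 160 * 2 ^ A.N k / A.N k + Δ * (kA + 1)

variable {A}

/-- With a layout, `f̂_k` is the XOR of `f` at the query points read off the block. [cite: Hirahara2022PartialMCSP, proof of Lemma 8.1 (definition of Amp^f)] -/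
theorem fhat_eq_parity (L : Layout A) (k : Fin n) (f : (Fin (A.N k) → Bool) → Bool) (y : Fin ℓ → Bool) :
    fhat A k f y = parityFin kA fun i => f (inp (A.eA k) (A.idxA k) i (seedOf fun sb => y (L.lay k sb))) := by
  unfold fhat amp
  rw [L.spec]

/-- **The block circuit of variable `k`**: from the NW seed `z`, all `Δ` values
`f̂_k(z|_{S_{(k,t)}})`, within `costK` gates (queries + Uhlig mass production of `f_k` on the
`Δ·k_A` query points + XOR). [cite: Hirahara2022PartialMCSP, proof of Lemma 8.3 (completeness) with Lemma 8.2] -/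
theorem cktSize_block (L : Layout A) {τ : ℕ} (k : Fin n) (hN : (2 * τ + 8) * (Nat.log 2 (A.N k) + 2) ≤ A.N k)
    (hρ : Δ * kA ≤ 2 ^ τ) (f : (Fin (A.N k) → Bool) → Bool) :
    CktSize B2 (fun (z : Fin dNW → Bool) (t : Fin Δ) => fhat A k f fun q => z (E (k, t) q)) (costK A Δ kA k) := by
  -- all queries
  have hQ : CktSize B2 (fun (z : Fin dNW → Bool) (p : (Fin Δ × Fin kA) × Fin (A.N k)) =>
      inp (A.eA k) (A.idxA k) p.1.2 (seedOf fun sb => z (E (k, p.1.1) (L.lay k sb))) p.2)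
      (Fintype.card (Fin Δ × Fin kA) * (A.N k * (2 * A.mI k + 3))) :=
    Uhlig.cktSize_prodPi (F := fun (ti : Fin Δ × Fin kA) (z : Fin dNW → Bool) (r : Fin (A.N k)) =>
        inp (A.eA k) (A.idxA k) ti.2 (seedOf fun sb => z (E (k, ti.1) (L.lay k sb))) r)
      fun ti => (cktSize_inp (A.eA k) (A.idxA k) ti.2).rewire fun sb => E (k, ti.1) (L.lay k sb)
  -- mass production of `f` on the query points
  have hM := hQ.comp (cktSize_massProduction hN f (ρ := Fin Δ × Fin kA) (by simpa using hρ))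
  -- XOR per position
  have hP : CktSize B2 (fun (v : Fin Δ × Fin kA → Bool) (t : Fin Δ) => parityFin kA fun i => v (t, i))
      (Fintype.card (Fin Δ) * (kA + 1)) :=
    CktSize.pi_const fun t => (cktSize_parityFin kA).rewire fun i => (t, i)
  have h := hM.comp hP
  refine (h.of_le (le_of_eq ?_)).congr fun z t => ?_
  · simp only [costK, Fintype.card_prod, Fintype.card_fin]
  · simp only [directProd]
    rw [fhat_eq_parity L]

variable (A) (T : Finset (Fin n))

/-- An enumeration of the witness set `T`. [folklore] -/
noncomputable def kOf (l : Fin T.card) : Fin n := (T.equivFin.symm l).val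

/-- Enumerated elements lie in `T`. [folklore] -/
theorem kOf_mem (l : Fin T.card) : kOf T l ∈ T := (T.equivFin.symm l).2

/-- The gate budget of all blocks of `T`. [cite: Hirahara2022PartialMCSP, proof of Lemma 8.3 (completeness: Σ_{k ∈ T} O(λ w(k)/log …))] -/
def costT (Δ kA : ℕ) : ℕ := ∑ k ∈ T, costK A Δ kA k

variable {A}

/-- **All blocks of the witness set**: from `z`, all values `f̂_k(z|_{S_{(k,t)}})`, `k ∈ T`, `t < Δ`.
[cite: Hirahara2022PartialMCSP, proof of Lemma 8.3 (completeness)] -/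
theorem cktSize_blocks (L : Layout A) {τ : ℕ} (hN : ∀ k ∈ T, (2 * τ + 8) * (Nat.log 2 (A.N k) + 2) ≤ A.N k)
    (hρ : Δ * kA ≤ 2 ^ τ) (F : Coins A) :
    CktSize B2 (fun (z : Fin dNW → Bool) (lt : Fin T.card × Fin Δ) =>
      fhat A (kOf T lt.1) (F (kOf T lt.1)) fun q => z (E (kOf T lt.1, lt.2) q)) (costT A T Δ kA) := by
  have h := Uhlig.cktSize_prodPi_fin
    (F := fun (l : Fin T.card) (z : Fin dNW → Bool) (t : Fin Δ) =>
      fhat A (kOf T l) (F (kOf T l)) fun q => z (E (kOf T l, t) q))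
    (s := fun l => costK A Δ kA (kOf T l)) fun l => cktSize_block E L (kOf T l) (hN _ (kOf_mem T l)) hρ (F (kOf T l))
  have hs : ∑ l : Fin T.card, costK A Δ kA (kOf T l) = costT A T Δ kA := by
    unfold costT kOf
    rw [← Finset.sum_coe_sort T]
    exact Fintype.sum_equiv T.equivFin.symm _ _ fun l => rfl
  rw [hs] at h
  exact h

end Blocks

/-! ### The bit-level sample index -/

section Bits

variable {ν Lj dNW mm Δ : ℕ}

/-- The bit-level index type: `Lj` bits for `j`, the NW seed, the share slots. [cite: Hirahara2022PartialMCSP, proof of Lemma 8.3 (the truth table is indexed by (zφ, s-part); j written in binary)] -/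
abbrev XB (Lj dNW mm Δ : ℕ) : Type := Fin Lj ⊕ (Fin dNW ⊕ (Fin mm × Fin Δ))

/-- The binary digits of a formula index. [folklore] -/
def jbits (Lj : ℕ) (j : Fin ν) : Fin Lj → Bool := fun i => j.val.testBit i

/-- **The bits of a sample index** `x = (j, z, ξ)`. [cite: Hirahara2022PartialMCSP, proof of Lemma 8.3] -/
def xbits (x : X ν dNW mm Δ) : XB Lj dNW mm Δ → Bool :=
  Sum.elim (jbits Lj x.1) (Sum.elim x.2.1 fun p => x.2.2 p.1 p.2)

/-- Binary digits are injective below `2^{Lj}`. [folklore] -/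
theorem jbits_injective (hν : ν ≤ 2 ^ Lj) : Function.Injective (jbits (ν := ν) Lj) := by
  intro j j' h
  apply Fin.ext
  apply Nat.eq_of_testBit_eq
  intro i
  by_cases hi : i < Lj
  · exact congrFun h ⟨i, hi⟩
  · rw [Nat.testBit_eq_false_of_lt (lt_of_lt_of_le (lt_of_lt_of_le j.isLt hν)
        (Nat.pow_le_pow_right (by norm_num) (by omega))),
      Nat.testBit_eq_false_of_lt (lt_of_lt_of_le (lt_of_lt_of_le j'.isLt hν)
        (Nat.pow_le_pow_right (by norm_num) (by omega)))]

end Bits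

/-! ### The completeness circuit -/

section Main

variable {n ℓ kA Δ dNW ν mm : ℕ} {A : AmpData n ℓ kA}
  (E : Fin n × Fin Δ → (Fin ℓ ↪ Fin dNW)) (φ : Fin ν → MonotoneDNF) (slot : Fin ν → Fin mm → Option (Fin n))

open Literature.Computability.MetaComplexity.MonotoneDNF.BenalohLeichter (firstTerm reconstruct lookup)
open Literature.Computability.Cryptography (restrictShares)

/-- The variable at a position of a term in range lies in that term, hence in the formula.
[folklore] -/
theorem varAt_mem_of_lt (φ₀ : MonotoneDNF) {kt p : ℕ} (hkt : kt < φ₀.length) (hp : p < φ₀.termLen kt) :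
    ∃ t ∈ φ₀, φ₀.varAt (kt, p) ∈ t := by
  refine ⟨φ₀[kt], List.getElem_mem hkt, ?_⟩
  unfold MonotoneDNF.varAt
  unfold MonotoneDNF.termLen at hp
  simp only
  rw [List.getD_eq_getElem _ _ hkt] at hp ⊢
  rw [List.getD_eq_getElem _ _ hp]
  exact List.getElem_mem hp

/-- **Linear reconstruction, explicit form** (Lemma 4.5): for an authorized `Tn`, the secret is the
XOR of the share bits `s_{v_p}[rank_p]` over the positions `p` of the first `Tn`-term, where `v_p` is
the variable at `p` and `rank_p` the rank of the occurrence `(firstTerm, p)` among the occurrences of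
`v_p`. [cite: Hirahara2022PartialMCSP, Lemma 4.5 ("Rec(φ, T, −) computes a linear function of s_T")] -/
theorem parityFin_shareBits_eq (φ₀ : MonotoneDNF) (hφ : [] ∉ φ₀) {Tn : Finset ℕ}
    (hT : Tn ∈ φ₀.accessStructure.authorized) (b : Bool) (r : BenalohLeichter.Rand φ₀) :
    parityFin (φ₀.termLen (firstTerm φ₀ Tn)) (fun p : Fin (φ₀.termLen (firstTerm φ₀ Tn)) =>
      (BenalohLeichter.share φ₀ b r (φ₀.varAt (firstTerm φ₀ Tn, p))).getD
        ((φ₀.occsOf (φ₀.varAt (firstTerm φ₀ Tn, p))).idxOf (firstTerm φ₀ Tn, (p : ℕ))) false) = b := by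
  have hc := MonotoneDNF.BenalohLeichter.correct φ₀ hφ Tn hT b r
  change reconstruct φ₀ Tn (restrictShares Tn (BenalohLeichter.share φ₀ b r)) = b at hc
  obtain ⟨_, hin⟩ := MonotoneDNF.BenalohLeichter.firstTerm_spec φ₀ hT
  have hrec : reconstruct φ₀ Tn (restrictShares Tn (BenalohLeichter.share φ₀ b r)) =
      parityFin (φ₀.termLen (firstTerm φ₀ Tn)) (fun p : Fin (φ₀.termLen (firstTerm φ₀ Tn)) =>
        (BenalohLeichter.share φ₀ b r (φ₀.varAt (firstTerm φ₀ Tn, p))).getD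
          ((φ₀.occsOf (φ₀.varAt (firstTerm φ₀ Tn, p))).idxOf (firstTerm φ₀ Tn, (p : ℕ))) false) := by
    rw [reconstruct, ← Fin.sum_univ_eq_sum_range, zBit_sum_bitZ]
    congr 1
    funext p
    unfold lookup
    rw [Cryptography.restrictShares_of_mem _ (hin p p.isLt)]
  exact hrec.symm.trans hc

/-- **Completeness of Hirahara's reduction (as a straight-line program).** If `T` satisfies every
formula, then for every outcome `F` of the coins some function `g` of the index bits with a
`B₂`-program of size `costT + (mintermBound Lj + ν(2Δ+1) + (2ν+1))` answers the secret at every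
sample point. [cite: Hirahara2022PartialMCSP, proof of Lemma 8.3 (completeness, pp. 29–30) with Lemma 8.2 and Lemma 4.5] -/
theorem cktSize_cons (L : Layout A) {τ Lj : ℕ} (T : Finset (Fin n)) (F : Coins A)
    (hN : ∀ k ∈ T, (2 * τ + 8) * (Nat.log 2 (A.N k) + 2) ≤ A.N k) (hρ : Δ * kA ≤ 2 ^ τ)
    (hν : ν ≤ 2 ^ Lj) (hφ : ∀ j, [] ∉ φ j) (hdeg : ∀ j, (φ j).numLiterals ≤ Δ)
    (hslot : ∀ (j : Fin ν) (t : List ℕ), t ∈ φ j → ∀ v ∈ t, ∃ (k : Fin n) (i : Fin mm), k.val = v ∧ slot j i = some k)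
    (hauth : ∀ j, T.image Fin.val ∈ (φ j).accessStructure.authorized) :
    ∃ g : (XB Lj dNW mm Δ → Bool) → Bool,
      CktSize B2 (fun x (_ : Unit) => g x)
        (costT A T Δ kA + (Lupanov.mintermBound Lj + ν * (2 * Δ + 1) + (2 * ν + 1))) ∧
      Cons E (Fhat A F) φ slot fun x => g (xbits x) := by
  classical
  -- selection data for each formula and each position of its first `T`-term
  set Tn := T.image Fin.val with hTn
  set ft : Fin ν → ℕ := fun j => firstTerm (φ j) Tn with hft
  set tl : Fin ν → ℕ := fun j => (φ j).termLen (ft j) with htl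
  have hsel : ∀ (j : Fin ν) (p : Fin (tl j)), ∃ (k : Fin n) (i : Fin mm) (ρ : Fin Δ),
      k ∈ T ∧ k.val = (φ j).varAt (ft j, (p : ℕ)) ∧ slot j i = some k ∧
        ρ.val = ((φ j).occsOf ((φ j).varAt (ft j, (p : ℕ)))).idxOf (ft j, (p : ℕ)) := by
    intro j p
    obtain ⟨hlt, hin⟩ := MonotoneDNF.BenalohLeichter.firstTerm_spec (φ j) (hauth j)
    have hv := hin p p.isLt
    obtain ⟨k, hkT, hkv⟩ := mem_image.1 hv
    obtain ⟨t, ht, hvt⟩ := varAt_mem_of_lt (φ j) hlt p.isLt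
    obtain ⟨k', i, hk'v, hsl⟩ := hslot j t ht _ hvt
    have hkk' : k' = k := Fin.ext (by rw [hk'v, hkv])
    subst hkk'
    have hocc : (ft j, (p : ℕ)) ∈ (φ j).occsOf ((φ j).varAt (ft j, (p : ℕ))) := by
      rw [MonotoneDNF.mem_occsOf]; exact ⟨⟨hlt, p.isLt⟩, rfl⟩
    have hρ : ((φ j).occsOf ((φ j).varAt (ft j, (p : ℕ)))).idxOf (ft j, (p : ℕ)) < Δ :=
      lt_of_lt_of_le (List.idxOf_lt_length_of_mem hocc)
        ((MonotoneDNF.length_occsOf_le _ _).trans (hdeg j))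
    exact ⟨k', i, ⟨_, hρ⟩, hkT, hkv.symm ▸ hk'v, hsl, rfl⟩
  choose kS iS ρS hkS hvS hsS hρS using hsel
  set lS : (j : Fin ν) → Fin (tl j) → Fin T.card := fun j p => T.equivFin ⟨kS j p, hkS j p⟩ with hlS
  have hkOf : ∀ j p, kOf T (lS j p) = kS j p := by
    intro j p; simp [kOf, hlS]
  -- stage A: keep the inputs, compute all blocks of `T`
  have hA : CktSize B2 (fun (x : XB Lj dNW mm Δ → Bool) => Sum.elim x fun (lt : Fin T.card × Fin Δ) =>
      fhat A (kOf T lt.1) (F (kOf T lt.1)) fun q => x (Sum.inr (Sum.inl (E (kOf T lt.1, lt.2) q))))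
      (0 + costT A T Δ kA) :=
    (CktSize.id B2).pair ((cktSize_blocks E T L hN hρ F).rewire fun q => (Sum.inr (Sum.inl q) : XB Lj dNW mm Δ))
  -- stage B: minterms of the `j`-bits and the reconstructions
  set recFn : (j : Fin ν) → (XB Lj dNW mm Δ ⊕ (Fin T.card × Fin Δ) → Bool) → Bool := fun j w =>
    parityFin (tl j) fun p => xor (w (Sum.inl (Sum.inr (Sum.inr (iS j p, ρS j p))))) (w (Sum.inr (lS j p, ρS j p)))
    with hrecFn
  have hRec : ∀ j, CktSize B2 (fun (w : XB Lj dNW mm Δ ⊕ (Fin T.card × Fin Δ) → Bool) (_ : Unit) => recFn j w)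
      (2 * Δ + 1) := by
    intro j
    have h1 : CktSize B2 (fun (w : XB Lj dNW mm Δ ⊕ (Fin T.card × Fin Δ) → Bool) (p : Fin (tl j)) =>
        xor (w (Sum.inl (Sum.inr (Sum.inr (iS j p, ρS j p))))) (w (Sum.inr (lS j p, ρS j p))))
        (Fintype.card (Fin (tl j)) * 1) :=
      CktSize.pi_const fun p => cktSize_bin xor _ _
    have h2 := h1.comp (cktSize_parityFin (tl j))
    have htl : tl j ≤ Δ := (MonotoneDNF.termLen_le_numLiterals _ _).trans (hdeg j)
    refine (h2.of_le ?_).congr fun w _ => rfl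
    rw [Fintype.card_fin]; omega
  have hB : CktSize B2 (fun (w : XB Lj dNW mm Δ ⊕ (Fin T.card × Fin Δ) → Bool) =>
      Sum.elim (fun (a : Fin Lj → Bool) => decide ((fun i => w (Sum.inl (Sum.inl i))) = a))
        (fun (j : Fin ν) => recFn j w))
      (Lupanov.mintermBound Lj + Fintype.card (Fin ν) * (2 * Δ + 1)) :=
    ((Lupanov.cktSize_allMinterms Lj).rewire fun i => (Sum.inl (Sum.inl i) : XB Lj dNW mm Δ ⊕ (Fin T.card × Fin Δ))).pair
      (CktSize.pi_const hRec)
  -- stage C: the masked XOR over `j`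
  have hC : CktSize B2 (fun (v : (Fin Lj → Bool) ⊕ Fin ν → Bool) (_ : Unit) =>
      parityFin ν fun j => v (Sum.inr j) && v (Sum.inl (jbits Lj j))) (2 * ν + 1) :=
    (Uhlig.cktSize_maskedParity ν).rewire (Sum.elim (fun j => Sum.inl (jbits Lj j)) fun j => Sum.inr j)
  have h := (hA.comp hB).comp hC
  refine ⟨_, (h.of_le (le_of_eq ?_)), ?_⟩
  · rw [Fintype.card_fin]; ring
  -- semantics at a sample point
  intro j z b r
  simp only [Sum.elim_inl, Sum.elim_inr]
  -- the `j`-bits select `j`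
  have hjb : ∀ i : Fin Lj, xbits (Lj := Lj) (point E (Fhat A F) φ slot j z b r) (Sum.inl i) = jbits Lj j i := fun i => rfl
  simp only [hjb]
  have hsel : ∀ j' : Fin ν, decide ((fun i => jbits Lj j i) = jbits Lj j') = decide (j = j') := by
    intro j'
    by_cases hjj : j = j'
    · subst hjj; simp
    · rw [decide_eq_false hjj, decide_eq_false]
      intro h; exact hjj (jbits_injective hν (funext fun i => congrFun h i))
  simp only [hsel]
  rw [parityFin_eq_of_unique ν _ j (fun j' hj' => by rw [decide_eq_false (Ne.symm hj')]; simp)]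
  rw [decide_eq_true rfl, Bool.and_true]
  -- the reconstruction of formula `j` returns `b`
  have hbits : ∀ p : Fin (tl j),
      xor (xbits (Lj := Lj) (point E (Fhat A F) φ slot j z b r) (Sum.inr (Sum.inr (iS j p, ρS j p))))
        (fhat A (kOf T (lS j p)) (F (kOf T (lS j p))) fun q =>
          xbits (Lj := Lj) (point E (Fhat A F) φ slot j z b r) (Sum.inr (Sum.inl (E (kOf T (lS j p), ρS j p) q)))) =
      (BenalohLeichter.share (φ j) b r (φ j |>.varAt (ft j, (p : ℕ)))).getD
        (((φ j).occsOf ((φ j).varAt (ft j, (p : ℕ)))).idxOf (ft j, (p : ℕ))) false := by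
    intro p
    rw [hkOf]
    simp only [xbits, point, Sum.elim_inr, Sum.elim_inl, xorV, readY, shareVec, hsS j p, realY, NWExtract.real,
      Fhat_apply]
    rw [← hρS j p, ← hvS j p]
    generalize fhat A (kS j p) (F (kS j p)) (fun q => z (E (kS j p, ρS j p) q)) = u
    generalize (BenalohLeichter.share (φ j) b r (kS j p).val).getD (ρS j p).val false = v
    cases u <;> cases v <;> rfl
  simp only [hrecFn, Sum.elim_inl, Sum.elim_inr, hbits]
  exact parityFin_shareBits_eq (φ j) (hφ j) (hauth j) b r

/-- **Completeness of Hirahara's reduction (as a circuit).** [cite: Hirahara2022PartialMCSP, proof of Lemma 8.3 (completeness, pp. 29–30)] -/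
theorem exists_circuit_cons (L : Layout A) {τ Lj : ℕ} (T : Finset (Fin n)) (F : Coins A)
    (hN : ∀ k ∈ T, (2 * τ + 8) * (Nat.log 2 (A.N k) + 2) ≤ A.N k) (hρ : Δ * kA ≤ 2 ^ τ)
    (hν : ν ≤ 2 ^ Lj) (hφ : ∀ j, [] ∉ φ j) (hdeg : ∀ j, (φ j).numLiterals ≤ Δ)
    (hslot : ∀ (j : Fin ν) (t : List ℕ), t ∈ φ j → ∀ v ∈ t, ∃ (k : Fin n) (i : Fin mm), k.val = v ∧ slot j i = some k)
    (hauth : ∀ j, T.image Fin.val ∈ (φ j).accessStructure.authorized) :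
    ∃ C : Circuit (XB Lj dNW mm Δ), C.IsOver B2 ∧
      C.size ≤ costT A T Δ kA + (Lupanov.mintermBound Lj + ν * (2 * Δ + 1) + (2 * ν + 1)) ∧
      ∀ (j : Fin ν) (z : Fin dNW → Bool) (b : Bool) (r : BenalohLeichter.Rand (φ j)),
        C.eval (xbits (point E (Fhat A F) φ slot j z b r)) = b := by
  obtain ⟨g, hg, hcons⟩ := cktSize_cons E φ slot L T F hN hρ hν hφ hdeg hslot hauth
  obtain ⟨C, hC, hs, hev⟩ := hg.toCircuit
  exact ⟨C, hC, hs, fun j z b r => by rw [hev]; exact hcons j z b r⟩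

end Main

end HiraharaRed

end Literature.Computability.Complexity
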